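import Literature.NumberTheory.EllipticCurves.Tian2014.ClassFiveFamilyDescentProofs
import HarnessLib

/-!
# Tian's class-`6` family `m = 2n`, `n = p₀p₁⋯p_k` (`p₀ ≡ 3 (mod 4)`, `pᵢ ≡ 1 (mod 8)`, odd graph):
# `s(2n) = 1`, condition (1.1), Thm. 1.3 for `E^{(2n)}`, and the PRINTED second genus sum `Σ₂′(2n)` is odd
# — UNIFORM-in-`k` kernel theorems (the last of the three classes of Tian 2014, Thm. 1.3)

HONEST FRAMING (cell `b2b-bsdres`, sub-lane «bsd-p2», literature seat `p2-lit-1`, charter "Tian 2014 /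
Tian–Yuan–Zhang 2017 / Cai–Li–Zhai AS PRINTED"): this file PROVES theorems — NO definition, NO named fact
(`def … : Prop`), NO `sorry`; every class-group statement is MODULO the displayed Rédei–Reichardt fact
`redeiReichardt_fourTwoCard_classGroup` (`hR`, Li–Ma 2008 Thm. 0.4), and §3 / §5 display Tian 2014 Thm. 1.3
(`h13`) resp. Tian–Yuan–Zhang 2017 Thm. 1.2 AS PRINTED (`h12 : thm12_parity_of_scriptL'`) the same way.  What
is proved is `𝔽₂`-linear algebra on Monsky's EVEN matrix and on Rédei's `RM(−8n)`, and bookkeeping on the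
printed genus sum `Σ₂′`.  It is NOT a `2`-part-of-BSD statement (see "What is NOT proved" below); the doors
`P2/…` are the typer's (one-writer rule) and are not imported here.  Nothing booked; no mark moved.

## The family (Tian, Camb. J. Math. 2 (2014), Thm. 1.3, Lemma 5.1, Thm. 5.2, Lemma 5.3)

Tian 2014, Thm. 1.3 [arXiv:1210.8231 p. 2 L5–L15]: "Let `k ≥ 0` be an integer and `n = p₀p₁⋯p_k` a
product of distinct odd primes with `pᵢ ≡ 1 mod 8` for `1 ≤ i ≤ k`. Assume that the ideal class group `𝒜`
of the field `K = ℚ(√−2n)` satisfies the condition: (1.1) `dim_{𝔽₂}(𝒜[4]/𝒜[2]) = 0` if `n ≡ ±3 mod 8`,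
`1` otherwise. Let `m = n` or `2n` such that `m ≡ 5, 6`, or `7 mod 8` … Then `rank_ℤ E^{(m)}(ℚ) = 1 =
ord_{s=1} L(E^{(m)}, s)`. Moreover, the Shafarevich–Tate group of `E^{(m)}` is finite and has odd
cardinality."  Thm. 5.2 [p. 28 L40–L43]: "… the product of `p₀` (resp. `2p₀`) and primes in any finite
subset of `Σ` is a congruent number if `p₀ ≡ 5, 7 mod 8` (resp. `p₀ ≡ 3 mod 4`)."  Lemma 5.1 [p. 28
L2–L14]: (1.1) ⟺ the graph `G` on `{p₀, …, p_k}` with edges `(pᵢ/pⱼ) = −1` has no proper even partition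
⟺ `G` has an odd number of spanning trees.  Lemma 5.3 [p. 28 L71 – p. 29 L32]: under (1.1),
(5.1) `dim_{𝔽₂} S^{(2)}(E^{(m)}/ℚ)/E^{(m)}[2] = 1`.

THIS FILE treats the member `m = 2n ≡ 6 (mod 8)`, i.e. `p₀ ≡ 3 (mod 4)` ("class 6"; both sub-cases
`p₀ ≡ 3` and `p₀ ≡ 7 (mod 8)`), with the graph condition in Feng's KERNEL FORM
`hG : ∀ v, A v = 0 → v = 0 ∨ v = (1,…,1)`, `A = legendreMatrix p` (symmetric here by reciprocity).  The
classes `m = n ≡ 7` and `m = n ≡ 5 (mod 8)` are the sibling files `ClassSevenFamilyDescentProofs.lean`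
(p326865) and `ClassFiveFamilyDescentProofs.lean` (p327635).  Binders throughout: `p : Fin (k+1) → ℕ`
injective primes, `h3 : p 0 % 4 = 3`, `h1 : p i % 8 = 1 (i ≠ 0)`, `hG`; `n = ∏ pᵢ`, the curve is
`congruentNumberCurve (2 * n) = E_{2n} : y² = x³ − (2n)²x ≅_ℚ E^{(2n)}`.

## What is PROVED (uniformly in `k`; `k = 0` is the family `2q`, `q ≡ 3 (mod 4)` prime)

* §1 `card_ker_monskyMatrixEven_caseSix`, `monskySelmerRankEven_caseSix`: Monsky's EVEN matrix
  `M = (Aᵀ + D₂, D₋₁; D₂, A + D₂)` (Heath-Brown 1994, appendix, `D = 2D₀`) has `D₋₁ = E₁₁`, `D₂ = E₁₁`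
  (`p₀ ≡ 3 (mod 8)`) resp. `0` (`p₀ ≡ 7`), `Aᵀ = A`, and kernel of size EXACTLY `2` (`{0, (1;1)}` resp.
  `{0, (1;0)}`): `s(2n) = 2(k+1) − rank M = 1` — Tian's (5.1) for `m = 2n` in Monsky's currency.
* §2 `condition11_caseThree` (mod `hR`), `condition11_caseSix`: Lemma 5.1 (⇐) for `p₀ ≡ 3 (mod 8)` —
  `RM(−8n)` on `(2; p₀, …, p_k)` is `(1 e₀ᵀ; e₀ A + E₀₀)` (`D₂ = 8`, `(D₀/2) = (−p₀/2) = −1`, `(8/p₀) = −1`),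
  kernel `{0, 1}`, so `dim 𝒜[4]/𝒜[2] = 0` = (1.1) for `n ≡ 3 (mod 8)`; together with the sibling's
  `condition11_caseSeven` (`p₀ ≡ 7`: dim `1`) this is (1.1) on the whole class-`6` family ((1.1) is a
  condition on `n` alone).
* §3 `thm13_two_mul_caseSix` (mod `h13`, `hR`): Tian's Thm. 1.3 applied with `m = 2n` and (1.1)
  DISCHARGED — `rank E_{2n}(ℚ) = 1 = ord_{s=1} L(E_{2n}, s)`, `Ш(E_{2n})` finite of ODD order, hence
  `Ш(E_{2n})[2^∞] = 0` (`card_primaryComponent_sha_two_two_mul_caseSix`).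
* §4 `odd_genusSum₂'_two_mul_caseSix` (mod `hR`): the second genus sum of Tian–Yuan–Zhang 2017 Thm. 1.2
  AS PRINTED, `Σ₂′(2n) = Σ_{2n = d₀d₁⋯d_ℓ, d₀ ≡ 5,6,7, d₁ ≡ 1,2,3, dᵢ ≡ 1 (8)} ∏ g(dᵢ)` (with its `ℓ = 0`
  term; `genusSum₂'`) over `K_d = GenusField d`, is ODD on the whole family.  Mechanism (the proof of
  TYZ Cor. 1.4, "by Rédei, `g(d)` is even for … `d = p₁⋯p_k ≡ 1 (mod 8)`, `pᵢ ≡ ±1`; `d = 2p₁⋯p_k`,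
  `pᵢ ≡ ±1 (mod 8)`"): every decomposition of `2n` other than `{2n}` and `{2, n}` has a block `d ∣ p₁⋯p_k`
  or `d = 2s`, `1 < s ∣ p₁⋯p_k`, with `g(d)` even (`even_genusClassNumber_of_dvd_caseSeven`,
  `even_genusClassNumber_two_mul_of_dvd`); `{2, n}` is counted iff `n ≡ 7 (mod 8)`; so
  `Σ₂′(2n) ≡ g(2n) + [n ≡ 7]·g(2)g(n) ≡ 1 (mod 2)` — for `p₀ ≡ 3`: `g(2n)` odd (§2); for `p₀ ≡ 7`: `g(2n)`
  even ((1.1), dim `1`), `g(n)` odd (`odd_genusClassNumber_caseSeven`), `g(2)` odd.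
* §5 `rankOneDatum_two_mul_caseSix'` (mod `h12`, `hR`): for every `ρ` with
  `[E_{2n}(ℚ) : φ(A(ℚ)) + E_{2n}[2]] = 2^ρ`, `ord_{s=1} L(E_{2n}, s) = 1` and
  `L′(E_{2n}, 1) = 2^{2k}·L²·Ω(E_{2n})·Reg(E_{2n})` with `L ∈ ℤ`, `L ≠ 0`, `ord₂ L ≤ ρ` (TYZ's class-`6`
  clause, `rankOneDatum_of_index_eq_two_pow_six'`); at `ρ = 0`, `L` is odd
  (`rankOneDatum_two_mul_caseSix_of_index_eq_one'`).

## What is NOT proved, and why (the `p = 2` flag of this file)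

`BSD(E_{2n}, 2)` for this family is NOT a printed theorem and does NOT follow from {Thm. 1.3, TYZ Thm. 1.2,
Rédei–Reichardt}: with `#Ш(E_{2n})` odd (§3), `#E_{2n}(ℚ)_tor = 4` and `∏ c_ℓ = 2^{2k+4}` (tree theorems)
the `2`-part of BSD reads `ord₂ L = 0`, i.e. `𝓛(2n)` ODD, whereas Thm. 1.2 at index `2^ρ` gives only
`2^{ρ+1} ∤ 𝓛(2n)` and the index on this family is `2` (`ρ(2n) = 1`; sub-lane census p2-monsky-x, EVIDENCE,
all `87 853` members below `3·10⁶`).  Tian 2014 Rem. 1.4 excludes `p ∣ 2m` from the `p`-part; Tian–Yuan–Zhang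
§1 / Cor. 1.4 print no class-`6` BSD₂ statement.  The missing bit `2 ∤ 𝓛(2n)` is exactly the output of the
sub-lane's conjectural strengthening "U⁺" (`2 ∣ 𝓛 ⇒ Σ₂′ even` without the `ρ` binder; p2-idea-2, desk
proof, NOT in print, NOT displayed anywhere): if U⁺ becomes a tree theorem (W2), §3 + §4 close `BSD(E_{2n}, 2)`
on the whole family modulo {`h13`, `hR`} and U⁺'s own displayed inputs — no Gross–Zagier–Kolyvagin, no Monsky
fact.  AT `p = 2`: every statement here is `2`-adic descent / genus data for `E_{2n}` (additive reduction
at `2`); no prime is excluded by any hypothesis.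

## References

* [Tian2014] Y. Tian, *Congruent numbers and Heegner points*, Camb. J. Math. 2 (2014) 117–161 =
  arXiv:1210.8231: Thm. 1.3 (p. 2 L5–L15), Rem. 1.4 (p. 2 L16–L22), Lemma 5.1 (p. 28 L2–L35), Thm. 5.2
  (p. 28 L40–L43), Lemma 5.3 and (5.1) (p. 28 L71 – p. 29 L32).
* [TianYuanZhang2017] Y. Tian, X. Yuan, S.-W. Zhang, *Genus periods, genus points and congruent number
  problem*, Asian J. Math. 21 (2017) 721–774 = arXiv:1411.4728: §1 (`g(d)`, `ρ(n)`; chunk p0002 L76–L110),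
  Thm. 1.2 (p0002 L112–L129), Cor. 1.4 and its proof (p0003 L13–L50), Thm. 3.5 (p0011 L94–L112).
* [HeathBrown1994SelmerCongruentII] D. R. Heath-Brown, appendix by P. Monsky, Invent. Math. 118 (1994),
  typescript p. 41 L20–L36 (the even matrix `M`, `s(D) = 2Ω(D₀) − rank M₁`).
* [Feng1996NonCongruent] K. Feng, Acta Arith. 75 (1996) 71–83, §2 Lemma 2.2 (odd graphs ⟺ `rank = t − 1`).
* [LiMa2008] Y. Li, L. Ma, Acta Arith. 134 (2008), Lemma 0.1, Def. 0.2, Thm. 0.4 (Rédei–Reichardt).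
* [IrelandRosen1990] K. Ireland, M. Rosen, GTM 84, Ch. 5 §1 Prop. 5.1.2, §2 Prop. 5.2.2 and Thm. 2.
* [Cox2013] D. A. Cox, *Primes of the form x² + ny²*, 2nd ed., §5.B (the symbol `(D/2)`).
* [HardyWright2008] G. H. Hardy, E. M. Wright, 6th ed., §17.8.
* Tree: `Tian2014/{ClassSevenFamilyDescentProofs, ClassFiveFamilyDescentProofs}.lean` (§0–§4 lemmas reused),
  `HeathBrown1994/CongruentTwoSelmerOddGraphFamilies.lean` (p2-monsky-lit; `s = 0` mirrors, §1–§2 lemmas),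
  `TianYuanZhang2017/{GenusPeriodsParity, GenusFieldFamily, ScriptLOddOfRhoZero}.lean`,
  `QuadraticFields/RedeiMatrixFourRank.lean`; HOME/p2/LIT-STATUS.md §T1 (rows T1-T2, T1-T5, T1-T7, T1-M31,
  T1-M33, T1-M38); unit `b2b-bsdres-p2-lit-1` GEN 8.
-/

noncomputable section

open scoped Classical

open Matrix Finset Literature.NumberTheory.EllipticCurves
  Literature.NumberTheory.EllipticCurves.HeathBrown1994
  Literature.NumberTheory.EllipticCurves.HeathBrown1994.Families
  Literature.NumberTheory.EllipticCurves.TianYuanZhang2017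
  Literature.NumberTheory.EllipticCurves.LiLiuTian2024.RedeiFamilies
  Literature.NumberTheory.QuadraticFields.RedeiReichardt

set_option autoImplicit false

namespace Literature.NumberTheory.EllipticCurves.Tian2014

variable {k : ℕ} (p : Fin (k + 1) → ℕ)

/-! ## §0 The family: residues, parity, the products `n` and `2n` -/

/-- In the class-`6` family every `pᵢ` is odd. [cite: Tian2014, Thm. 1.3 (arXiv p. 2, L5–L7: distinct odd primes)] -/
theorem odd_of_caseSix (h3 : p 0 % 4 = 3) (h1 : ∀ i, i ≠ 0 → p i % 8 = 1) (i : Fin (k + 1)) :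
    Odd (p i) := by
  rcases eq_or_ne i 0 with rfl | hi
  · exact Nat.odd_iff.mpr (by omega)
  · have := h1 i hi; exact Nat.odd_iff.mpr (by omega)

/-- In the class-`6` family no `pᵢ` is `2`. [cite: Tian2014, Thm. 1.3 (arXiv p. 2, L5–L7)] -/
theorem ne_two_of_caseSix (h3 : p 0 % 4 = 3) (h1 : ∀ i, i ≠ 0 → p i % 8 = 1) (i : Fin (k + 1)) :
    p i ≠ 2 := fun h => by
  have := odd_of_caseSix p h3 h1 i
  rw [h] at this
  exact (Nat.not_odd_iff_even.mpr even_two) this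

/-- `p₀ ≡ 3 (mod 4)` means `p₀ ≡ 3` or `7 (mod 8)` — the two sub-cases of the class-`6` family.
[cite: Tian2014, Thm. 5.2 (arXiv p. 28, L40–L43: "p₀ ≡ 3 mod 4")] -/
theorem mod_eight_zero_of_caseSix (h3 : p 0 % 4 = 3) : p 0 % 8 = 3 ∨ p 0 % 8 = 7 := by
  omega

/-- `n = p₀p₁⋯p_k ≡ p₀ (mod 8)` in the class-`6` family. [cite: Tian2014, Thm. 1.3 (arXiv p. 2, L5–L12)] -/
theorem prod_mod_eight_caseSix (h1 : ∀ i, i ≠ 0 → p i % 8 = 1) :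
    (∏ i, p i) % 8 = p 0 % 8 := by
  rw [Fin.prod_univ_succ, Nat.mul_mod, Finset.prod_nat_mod]
  have h : ∀ i : Fin k, p i.succ % 8 = 1 := fun i => h1 _ (Fin.succ_ne_zero i)
  simp only [h, Finset.prod_const_one, Nat.one_mod, mul_one, Nat.mod_mod]

/-- `n ≡ 3 (mod 4)` in the class-`6` family. [cite: Tian2014, Thm. 5.2 (arXiv p. 28, L40–L43)] -/
theorem prod_mod_four_caseSix (h3 : p 0 % 4 = 3) (h1 : ∀ i, i ≠ 0 → p i % 8 = 1) :
    (∏ i, p i) % 4 = 3 := by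
  have := prod_mod_eight_caseSix p h1; omega

/-- `m = 2n ≡ 6 (mod 8)` in the class-`6` family — Tian's case `m ≡ 6 (mod 8)`.
[cite: Tian2014, Thm. 1.3 (arXiv p. 2, L11–L12: m ≡ 5, 6, 7 mod 8)] -/
theorem two_mul_prod_mod_eight_caseSix (h3 : p 0 % 4 = 3) (h1 : ∀ i, i ≠ 0 → p i % 8 = 1) :
    (2 * ∏ i, p i) % 8 = 6 := by
  have := prod_mod_four_caseSix p h3 h1; omega

/-- `n = ∏ pᵢ > 1` for a nonempty tuple of primes. [cite: HardyWright2008, §17.8] -/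
theorem one_lt_prod_caseSix (hp : ∀ i, (p i).Prime) : 1 < ∏ i, p i := by
  rw [Fin.prod_univ_succ]
  exact lt_of_lt_of_le (hp 0).one_lt
    (Nat.le_mul_of_pos_right _ (Finset.prod_pos fun i _ => (hp i.succ).pos))

/-! ## §1 Monsky's EVEN matrix on the family: kernel of size `2`, i.e. `s(2n) = 1` (Tian's (5.1) for `m = 2n`) -/

/-- `D₋₁ = E₁₁` on the class-`6` family: `(−1/p₀) = −1` (`p₀ ≡ 3 (mod 4)`, the tree's
`DeuringLadic.jacobiSym_neg_one_of_mod_four`), `(−1/pᵢ) = +1` (`pᵢ ≡ 1`).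
[cite: IrelandRosen1990, Ch. 5 §2 Prop. 5.2.2] [cite: HeathBrown1994SelmerCongruentII, Appendix (Monsky), typescript p. 41 L20–L26 (D₋₁)] -/
theorem legendreDiagonal_neg_one_caseSix (h3 : p 0 % 4 = 3) (h1 : ∀ i, i ≠ 0 → p i % 8 = 1) :
    legendreDiagonal p (-1) =
      Matrix.diagonal fun j : Fin (k + 1) => if j = 0 then (1 : ZMod 2) else 0 := by
  unfold legendreDiagonal
  congr 1
  ext j
  rcases eq_or_ne j 0 with rfl | hj
  · rw [if_pos rfl]; exact addLegendreSym_of_eq_neg_one (DeuringLadic.jacobiSym_neg_one_of_mod_four h3)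
  · rw [if_neg hj]; exact addLegendreSym_of_eq_one (jacobiSym_neg_one_eq_one (by have := h1 j hj; omega))

/-- **Kernel of Monsky's even matrix, sub-case `p₀ ≡ 3 (mod 8)`.**  Here `D₂ = D₋₁ = E₁₁` and `Aᵀ = A`, so
`M = (A + E, E; E, A + E)` and `M(x; y) = 0 ⟺ Ax = Ay = E(x + y)`; column sums of `A` vanish, so
`x₀ + y₀ = 0`, `Ax = Ay = 0`, `x, y ∈ {0, 1}` with `x₀ = y₀`: `ker M = {(0;0), (1;1)}`.
[cite: HeathBrown1994SelmerCongruentII, Appendix (Monsky), typescript p. 41 L20–L36 (the even matrix; evaluation ours)]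
[cite: Tian2014, Lemma 5.3 and (5.1) (arXiv p. 28 L71 – p. 29 L32)] -/
theorem monskyMatrixEven_mulVec_eq_zero_iff_caseSix_three (h30 : p 0 % 8 = 3)
    (h1 : ∀ i, i ≠ 0 → p i % 8 = 1) (hG : ∀ v, legendreMatrix p *ᵥ v = 0 → v = 0 ∨ v = fun _ => 1)
    (z : Fin (k + 1) ⊕ Fin (k + 1) → ZMod 2) :
    monskyMatrixEven p *ᵥ z = 0 ↔ z = 0 ∨ z = fun _ => 1 := by
  have hodd := odd_of_caseSix p (by omega) h1
  have hsymm := legendreMatrix_transpose_eq p hodd (mod_four_of_caseSeven p h1)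
  set E : Matrix (Fin (k + 1)) (Fin (k + 1)) (ZMod 2) :=
    Matrix.diagonal fun j : Fin (k + 1) => if j = 0 then (1 : ZMod 2) else 0 with hE
  have hD2 : legendreDiagonal p 2 = E := legendreDiagonal_two_caseOne p h30 h1
  have hDm1 : legendreDiagonal p (-1) = E := legendreDiagonal_neg_one_caseSix p (by omega) h1
  constructor
  · intro hz
    obtain ⟨x, y, rfl⟩ : ∃ x y, z = Sum.elim x y :=
      ⟨z ∘ Sum.inl, z ∘ Sum.inr, (Sum.elim_comp_inl_inr z).symm⟩
    rw [monskyMatrixEven, hsymm, hD2, hDm1, Matrix.fromBlocks_mulVec] at hz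
    simp only [Sum.elim_comp_inl, Sum.elim_comp_inr] at hz
    have htop : (legendreMatrix p + E) *ᵥ x + E *ᵥ y = 0 := by
      funext i; have := congr_fun hz (Sum.inl i); simpa only [Sum.elim_inl, Pi.zero_apply] using this
    have hbot : E *ᵥ x + (legendreMatrix p + E) *ᵥ y = 0 := by
      funext i; have := congr_fun hz (Sum.inr i); simpa only [Sum.elim_inr, Pi.zero_apply] using this
    have hAx : legendreMatrix p *ᵥ x = E *ᵥ (x + y) := by
      rw [Matrix.add_mulVec, add_assoc, ← Matrix.mulVec_add] at htop
      rw [eq_neg_of_add_eq_zero_left htop, neg_eq_self_pi]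
    have hAy : legendreMatrix p *ᵥ y = E *ᵥ (x + y) := by
      have h2 : legendreMatrix p *ᵥ y + E *ᵥ (x + y) = 0 := by
        rw [Matrix.add_mulVec] at hbot
        rw [Matrix.mulVec_add]
        calc legendreMatrix p *ᵥ y + (E *ᵥ x + E *ᵥ y)
            = E *ᵥ x + (legendreMatrix p *ᵥ y + E *ᵥ y) := by abel
          _ = 0 := hbot
      rw [eq_neg_of_add_eq_zero_left h2, neg_eq_self_pi]
    obtain ⟨hxy0, hAx0⟩ := mulVec_eq_zero_of_eq_indicator p hsymm hAx
    obtain ⟨-, hAy0⟩ := mulVec_eq_zero_of_eq_indicator p hsymm hAy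
    have h01 : ∀ c d : ZMod 2, c + d = 0 → c = d := by decide
    have hx0y0 : x 0 = y 0 := h01 _ _ hxy0
    rcases hG x hAx0 with hx | hx <;> rcases hG y hAy0 with hy | hy
    · left; subst hx; subst hy; funext i; cases i <;> rfl
    · exfalso; subst hx; subst hy; exact zero_ne_one hx0y0
    · exfalso; subst hx; subst hy; exact zero_ne_one hx0y0.symm
    · right; subst hx; subst hy; funext i; cases i <;> rfl
  · rintro (rfl | rfl)
    · exact Matrix.mulVec_zero _
    · rw [monskyMatrixEven, hsymm, hD2, hDm1, Matrix.fromBlocks_mulVec]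
      have e1 : ((fun _ => (1 : ZMod 2)) : Fin (k + 1) ⊕ Fin (k + 1) → ZMod 2) ∘ Sum.inl = fun _ => 1 := rfl
      have e2 : ((fun _ => (1 : ZMod 2)) : Fin (k + 1) ⊕ Fin (k + 1) → ZMod 2) ∘ Sum.inr = fun _ => 1 := rfl
      rw [e1, e2, Matrix.add_mulVec, legendreMatrix_mulVec_one, zero_add]
      have hEE : E *ᵥ (fun _ => (1 : ZMod 2)) + E *ᵥ (fun _ => 1) = 0 := by
        funext a; exact CharTwo.add_self_eq_zero _
      rw [hEE]
      funext i; cases i <;> rfl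

/-- **Kernel of Monsky's even matrix, sub-case `p₀ ≡ 7 (mod 8)`.**  Here `D₂ = 0`, `D₋₁ = E₁₁`, `Aᵀ = A`, so
`M = (A, E; 0, A)`: the top block `Ax = Ey` forces `y₀ = 0` and `Ax = 0` (column sums of `A` vanish), the
bottom block `Ay = 0` with `y₀ = 0` forces `y = 0`: `ker M = {(0;0), (1;0)}`.
[cite: HeathBrown1994SelmerCongruentII, Appendix (Monsky), typescript p. 41 L20–L36 (the even matrix; evaluation ours)]
[cite: Tian2014, Lemma 5.3 and (5.1) (arXiv p. 28 L71 – p. 29 L32)] -/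
theorem monskyMatrixEven_mulVec_eq_zero_iff_caseSix_seven (h7 : p 0 % 8 = 7)
    (h1 : ∀ i, i ≠ 0 → p i % 8 = 1) (hG : ∀ v, legendreMatrix p *ᵥ v = 0 → v = 0 ∨ v = fun _ => 1)
    (z : Fin (k + 1) ⊕ Fin (k + 1) → ZMod 2) :
    monskyMatrixEven p *ᵥ z = 0 ↔ z = 0 ∨ z = Sum.elim (fun _ => 1) 0 := by
  have hodd := odd_of_caseSix p (by omega) h1
  have hsymm := legendreMatrix_transpose_eq p hodd (mod_four_of_caseSeven p h1)
  set E : Matrix (Fin (k + 1)) (Fin (k + 1)) (ZMod 2) :=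
    Matrix.diagonal fun j : Fin (k + 1) => if j = 0 then (1 : ZMod 2) else 0 with hE
  have hD2 : legendreDiagonal p 2 = 0 := legendreDiagonal_two_caseSeven p h7 h1
  have hDm1 : legendreDiagonal p (-1) = E := legendreDiagonal_neg_one_caseSix p (by omega) h1
  constructor
  · intro hz
    obtain ⟨x, y, rfl⟩ : ∃ x y, z = Sum.elim x y :=
      ⟨z ∘ Sum.inl, z ∘ Sum.inr, (Sum.elim_comp_inl_inr z).symm⟩
    rw [monskyMatrixEven, hsymm, hD2, hDm1, add_zero, Matrix.fromBlocks_mulVec] at hz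
    simp only [Sum.elim_comp_inl, Sum.elim_comp_inr, Matrix.zero_mulVec, zero_add] at hz
    have htop : legendreMatrix p *ᵥ x + E *ᵥ y = 0 := by
      funext i; have := congr_fun hz (Sum.inl i); simpa only [Sum.elim_inl, Pi.zero_apply] using this
    have hbot : legendreMatrix p *ᵥ y = 0 := by
      funext i; have := congr_fun hz (Sum.inr i); simpa only [Sum.elim_inr, Pi.zero_apply] using this
    have hAx : legendreMatrix p *ᵥ x = E *ᵥ y := by
      rw [eq_neg_of_add_eq_zero_left htop, neg_eq_self_pi]
    obtain ⟨hy0, hAx0⟩ := mulVec_eq_zero_of_eq_indicator p hsymm hAx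
    have hy : y = 0 := eq_zero_of_mulVec_eq_zero p hG hbot hy0
    subst hy
    rcases hG x hAx0 with hx | hx
    · left; subst hx; funext i; cases i <;> rfl
    · right; subst hx; funext i; cases i <;> rfl
  · rintro (rfl | rfl)
    · exact Matrix.mulVec_zero _
    · rw [monskyMatrixEven, hsymm, hD2, hDm1, add_zero, Matrix.fromBlocks_mulVec]
      simp only [Sum.elim_comp_inl, Sum.elim_comp_inr, Matrix.zero_mulVec, Matrix.mulVec_zero, add_zero,
        legendreMatrix_mulVec_one]
      funext i; cases i <;> rfl

/-- **`#ker M = 2` for Monsky's EVEN matrix on Tian's class-`6` family** (`2n = 2p₀p₁⋯p_k`, `p₀ ≡ 3 (mod 4)`,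
`pᵢ ≡ 1 (mod 8)`, `G(n)` odd), uniformly in `k` — `s(2n) = 1`, the `2`-Selmer shape (5.1) of Lemma 5.3 for
`m = 2n`, with NO per-`n` certificate.
[cite: Tian2014, Lemma 5.3 and (5.1) (arXiv p. 28 L71 – p. 29 L32)]
[cite: HeathBrown1994SelmerCongruentII, Appendix (Monsky), typescript p. 41 L20–L36] -/
theorem card_ker_monskyMatrixEven_caseSix (h3 : p 0 % 4 = 3) (h1 : ∀ i, i ≠ 0 → p i % 8 = 1)
    (hG : ∀ v, legendreMatrix p *ᵥ v = 0 → v = 0 ∨ v = fun _ => 1) :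
    Fintype.card {z : Fin (k + 1) ⊕ Fin (k + 1) → ZMod 2 // monskyMatrixEven p *ᵥ z = 0} = 2 := by
  rcases mod_eight_zero_of_caseSix p h3 with h30 | h7
  · rw [Fintype.card_of_subtype ({0, fun _ => 1} : Finset (Fin (k + 1) ⊕ Fin (k + 1) → ZMod 2))
      (fun z => by
        rw [Finset.mem_insert, Finset.mem_singleton]
        exact (monskyMatrixEven_mulVec_eq_zero_iff_caseSix_three p h30 h1 hG z).symm)]
    refine Finset.card_pair fun h => ?_
    exact zero_ne_one (congr_fun h (Sum.inl 0))
  · rw [Fintype.card_of_subtype ({0, Sum.elim (fun _ => 1) 0} : Finset (Fin (k + 1) ⊕ Fin (k + 1) → ZMod 2))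
      (fun z => by
        rw [Finset.mem_insert, Finset.mem_singleton]
        exact (monskyMatrixEven_mulVec_eq_zero_iff_caseSix_seven p h7 h1 hG z).symm)]
    refine Finset.card_pair fun h => ?_
    exact zero_ne_one (congr_fun h (Sum.inl 0))

/-- "`s(D) = 2Ω(D₀) − rank M`" read off a kernel count of `2` (even case): `s = 1`.
[cite: HeathBrown1994SelmerCongruentII, Appendix (Monsky), typescript p. 41 L36] -/
theorem monskySelmerRankEven_eq_one_of_card_ker
    (h2 : Fintype.card {z : Fin (k + 1) ⊕ Fin (k + 1) → ZMod 2 // monskyMatrixEven p *ᵥ z = 0} = 2) :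
    monskySelmerRankEven p = 1 := by
  have hcard := natCard_ker_mulVecLin_eq (monskyMatrixEven p)
  have h2' : Nat.card (LinearMap.ker (monskyMatrixEven p).mulVecLin) = 2 := by
    rw [Nat.card_congr (Equiv.subtypeEquivRight (q := fun v => monskyMatrixEven p *ᵥ v = 0)
      fun v => by rw [LinearMap.mem_ker, Matrix.mulVecLin_apply]), Nat.card_eq_fintype_card]
    exact h2
  rw [h2', Fintype.card_sum, Fintype.card_fin] at hcard
  unfold monskySelmerRankEven
  have key : k + 1 + (k + 1) - (monskyMatrixEven p).rank = 1 := by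
    by_contra hne
    rcases Nat.lt_or_gt_of_ne hne with hlt | hgt
    · have h0 : k + 1 + (k + 1) - (monskyMatrixEven p).rank = 0 := by omega
      rw [h0, pow_zero] at hcard; omega
    · have : (2 : ℕ) ^ 2 ≤ 2 ^ (k + 1 + (k + 1) - (monskyMatrixEven p).rank) :=
        Nat.pow_le_pow_right two_pos hgt
      omega
  omega

/-- **`s(2n) = 2(k+1) − rank M = 1` on Tian's class-`6` family** (Monsky's printed reading) — Tian's (5.1)
`dim_{𝔽₂} S^{(2)}(E^{(2n)}/ℚ)/E^{(2n)}[2] = 1` in the currency of Monsky's even matrix, uniformly in `k`.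
[cite: HeathBrown1994SelmerCongruentII, Appendix (Monsky), typescript p. 41 L36] [cite: Tian2014, (5.1) (arXiv p. 29)] -/
theorem monskySelmerRankEven_caseSix (h3 : p 0 % 4 = 3) (h1 : ∀ i, i ≠ 0 → p i % 8 = 1)
    (hG : ∀ v, legendreMatrix p *ᵥ v = 0 → v = 0 ∨ v = fun _ => 1) :
    monskySelmerRankEven p = 1 :=
  monskySelmerRankEven_eq_one_of_card_ker p (card_ker_monskyMatrixEven_caseSix p h3 h1 hG)

/-! ## §2 Tian's Lemma 5.1 (⇐) for `p₀ ≡ 3 (mod 8)`, modulo Rédei–Reichardt: `G(n)` odd ⟹ (1.1), `dim 𝒜[4]/𝒜[2] = 0` -/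

section RedeiTwoNThree

variable {n : ℕ}

/-- `D₂ = 8` for `D = −8n`, `n ≡ 3 (mod 4)` (`2n ≡ 6 (mod 8)`; Li–Ma's choice with `∏ Dᵢ = D`:
`D₀ = −p₀`, `Dᵢ = pᵢ`, `∏ Dᵢ = −n`). [cite: LiMa2008, Lemma 0.1 (p. 279)] -/
theorem primeDisc_two_mul_two_of_mod_four_three (hn4 : n % 4 = 3) : primeDisc (2 * n) 2 = 8 := by
  unfold primeDisc
  rw [if_pos rfl, if_neg (by omega), if_pos (by omega)]

/-- `(8/q) = (2/q) = −1` for a prime `q ≡ ±3 (mod 8)`: `kroneckerBit 8 q = 1`.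
[cite: IrelandRosen1990, Ch. 5 §2 Prop. 5.2.2 (second supplement)] -/
theorem kroneckerBit_eight_eq_one {q : ℕ} (hq : q.Prime) (h8 : q % 8 = 3 ∨ q % 8 = 5) :
    kroneckerBit 8 q = 1 := by
  have hq2 : q ≠ 2 := by omega
  rw [kroneckerBit_eq_addLegendreSym hq hq2 (eight_ne_zero hq hq2)]
  apply addLegendreSym_of_eq_neg_one
  have hgcd : Int.gcd 2 q = 1 := by
    have h := Int.gcd_natCast_natCast 2 q
    rw [(Nat.coprime_primes Nat.prime_two hq).mpr (Ne.symm hq2)] at h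
    simpa using h
  rw [show (8 : ℤ) = 2 ^ 2 * 2 by norm_num, jacobiSym.mul_left, jacobiSym.pow_left,
    jacobiSym.sq_one hgcd, one_mul]
  exact jacobiSym_two_eq_neg_one h8

/-- Row of the prime `2` in `RM(−8n)`, sub-case `p₀ ≡ 3 (mod 8)`: `[(D_b/2) = −1] = [D_b ≡ 5 (mod 8)]` is `1`
for `b = 0` (`D₀ = −p₀ ≡ 5 (mod 8)`) and `0` for `b ≠ 0` (`D_b = p_b ≡ 1`). [cite: LiMa2008, Def. 0.2 (p. 279)] [cite: Cox2013, §5.B ((D/2) = −1 iff D ≡ 5 mod 8)] -/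
theorem redeiMatrix_two_mul_zero_succ_caseThree (h30 : p 0 % 8 = 3)
    (h1 : ∀ i, i ≠ 0 → p i % 8 = 1) (b : Fin (k + 1)) :
    redeiMatrix (2 * n) (Fin.cons 2 p) 0 b.succ = if b = 0 then 1 else 0 := by
  have hp2 : p b ≠ 2 := ne_two_of_caseSix p (by omega) h1 b
  rw [redeiMatrix_apply_of_ne _ _ (Fin.succ_ne_zero b).symm, Fin.cons_zero, Fin.cons_succ,
    kroneckerBit_two, primeDisc_of_ne_two _ hp2]
  rcases eq_or_ne b 0 with rfl | hb
  · rw [if_neg (show ¬ p 0 % 4 = 1 by omega), if_pos, if_pos rfl]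
    have : ((p 0 : ℕ) : ℤ) % 8 = 3 := by exact_mod_cast h30
    omega
  · rw [if_pos (mod_four_of_caseSeven p h1 b hb), if_neg, if_neg hb]
    have := h1 b hb
    have : ((p b : ℕ) : ℤ) % 8 = 1 := by exact_mod_cast this
    omega

/-- Column of the prime `2` in `RM(−8n)`, sub-case `p₀ ≡ 3 (mod 8)`: `[(8/pₐ) = −1]` is `1` for `a = 0`
(`(2/p₀) = −1`) and `0` for `a ≠ 0` (`pₐ ≡ 1 (mod 8)`). [cite: LiMa2008, Def. 0.2 (p. 279)] [cite: IrelandRosen1990, Ch. 5 §2 Prop. 5.2.2] -/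
theorem redeiMatrix_two_mul_succ_zero_caseThree (hp : ∀ i, (p i).Prime) (h30 : p 0 % 8 = 3)
    (h1 : ∀ i, i ≠ 0 → p i % 8 = 1) (hn4 : n % 4 = 3) (a : Fin (k + 1)) :
    redeiMatrix (2 * n) (Fin.cons 2 p) a.succ 0 = if a = 0 then 1 else 0 := by
  rw [redeiMatrix_apply_of_ne _ _ (Fin.succ_ne_zero a), Fin.cons_zero, Fin.cons_succ,
    primeDisc_two_mul_two_of_mod_four_three hn4]
  rcases eq_or_ne a 0 with rfl | ha
  · rw [if_pos rfl]; exact kroneckerBit_eight_eq_one (hp 0) (Or.inl h30)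
  · rw [if_neg ha]; exact kroneckerBit_eight_eq_zero (hp a) (Or.inl (h1 a ha))

/-- Prime-to-prime entries of `RM(−8n)` on the class-`6` family are Monsky's `A`: `[(D_b/pₐ) = −1] = [(p_b/pₐ) = −1]`
(`D_b = p_b` for `b ≠ 0`; `D₀ = −p₀` and `(−1/pₐ) = +1` for `a ≠ 0`) — for any `p₀ ≡ 3 (mod 4)`.
[cite: LiMa2008, Def. 0.2 (p. 279)] [cite: IrelandRosen1990, Ch. 5 §2 Prop. 5.2.2 and Thm. 2] -/
theorem redeiMatrix_two_mul_succ_succ_caseSix (hp : ∀ i, (p i).Prime) (hinj : Function.Injective p)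
    (h3 : p 0 % 4 = 3) (h1 : ∀ i, i ≠ 0 → p i % 8 = 1) {a b : Fin (k + 1)} (hab : a ≠ b) :
    redeiMatrix (2 * n) (Fin.cons 2 p) a.succ b.succ = legendreMatrix p a b := by
  have hodd := odd_of_caseSix p h3 h1
  have hp2 : ∀ i, p i ≠ 2 := ne_two_of_caseSix p h3 h1
  have hne : (((p b : ℕ) : ℤ) : ZMod (p a)) ≠ 0 :=
    natCast_ne_zero_of_prime_ne (hp a) (hp b) fun h => hab.symm (hinj h)
  rw [redeiMatrix_apply_of_ne _ _ (fun h => hab (Fin.succ_inj.mp h)), Fin.cons_succ, Fin.cons_succ,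
    primeDisc_of_ne_two _ (hp2 b), legendreMatrix_apply_of_ne p hab]
  rcases eq_or_ne b 0 with rfl | hb
  · -- `D₀ = −p₀`; `a ≠ 0` so `pₐ ≡ 1 (mod 4)` and `(−p₀/pₐ) = (p₀/pₐ)`
    have h4 : p a % 4 = 1 := mod_four_of_caseSeven p h1 a hab
    rw [if_neg (show ¬ p 0 % 4 = 1 by omega),
      kroneckerBit_eq_addLegendreSym (hp a) (hp2 a) (by rw [Int.cast_neg]; exact neg_ne_zero.mpr hne),
      addLegendreSym_def,
      addLegendreSym_def, jacobiSym.neg _ (hodd a), ZMod.χ₄_nat_one_mod_four h4, one_mul]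
  · rw [if_pos (mod_four_of_caseSeven p h1 b hb)]
    exact kroneckerBit_eq_addLegendreSym (hp a) (hp2 a) hne

/-- **`RM(−8n)` applied to a vector, sub-case `p₀ ≡ 3 (mod 8)`**: `RM(−8n) = (1 e₀ᵀ; e₀ A + E₀₀)` in the basis
`(2; p₀, …, p_k)`: coordinate of `2` = `x₂ + x_{p₀}`, coordinate of `pₐ` = `[a = 0](x_{p₀} + x₂) + (Aξ)ₐ` (the same
shape as on the class-`5` family). [cite: LiMa2008, Def. 0.2 (p. 279); evaluation ours] [cite: Tian2014, proof of Lemma 5.1 (arXiv p. 28: the Rédei matrix of ℚ(√−2n) via the graph)] -/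
theorem redeiMatrix_two_mul_mulVec_caseThree (hp : ∀ i, (p i).Prime) (hinj : Function.Injective p)
    (h30 : p 0 % 8 = 3) (h1 : ∀ i, i ≠ 0 → p i % 8 = 1) (hn4 : n % 4 = 3)
    (x : Fin (k + 1 + 1) → ZMod 2) (i : Fin (k + 1 + 1)) :
    (redeiMatrix (2 * n) (Fin.cons 2 p) *ᵥ x) i =
      Fin.cases (motive := fun _ => ZMod 2) (x 0 + x (Fin.succ 0))
        (fun a => (if a = 0 then x (Fin.succ 0) + x 0 else 0) + (legendreMatrix p *ᵥ (x ∘ Fin.succ)) a) i := by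
  rw [mulVec_apply_eq_sum_of_diag _ (redeiMatrix_apply_self _ _) x i, Fin.sum_univ_succ]
  refine Fin.cases ?_ (fun a => ?_) i
  · rw [Fin.cases_zero, CharTwo.add_self_eq_zero, mul_zero, zero_add]
    rw [Finset.sum_eq_single (0 : Fin (k + 1))]
    · rw [redeiMatrix_two_mul_zero_succ_caseThree p h30 h1, if_pos rfl, one_mul]
    · intro b _ hb
      rw [redeiMatrix_two_mul_zero_succ_caseThree p h30 h1, if_neg hb, zero_mul]
    · intro h; exact absurd (Finset.mem_univ _) h
  · rw [Fin.cases_succ, redeiMatrix_two_mul_succ_zero_caseThree p hp h30 h1 hn4 a,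
      legendreMatrix_mulVec_apply_eq_sum]
    congr 1
    · rcases eq_or_ne a 0 with rfl | ha
      · rw [if_pos rfl, if_pos rfl, one_mul]
      · rw [if_neg ha, if_neg ha, zero_mul]
    · refine Finset.sum_congr rfl fun b _ => ?_
      rcases eq_or_ne a b with rfl | hab
      · simp only [Function.comp_apply, CharTwo.add_self_eq_zero, mul_zero]
      · rw [redeiMatrix_two_mul_succ_succ_caseSix p hp hinj (by omega) h1 hab]; rfl

/-- **Kernel of `RM(−8n)`, sub-case `p₀ ≡ 3 (mod 8)`, = `{0, 1}`** (`G(n)` odd): `2` elements, `r₄ = 0` —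
`dim_{𝔽₂} 𝒜[4]/𝒜[2] = 0` for `𝒜 = Cl(ℚ(√−2n))`, `n ≡ 3 (mod 8)`, as (1.1) demands for `n ≡ ±3 (mod 8)`.
[cite: Tian2014, Lemma 5.1 (arXiv p. 28 L2–L16)] [cite: LiMa2008, Thm. 0.4 (p. 280)] -/
theorem card_ker_redeiMatrix_two_mul_caseThree (hp : ∀ i, (p i).Prime) (hinj : Function.Injective p)
    (h30 : p 0 % 8 = 3) (h1 : ∀ i, i ≠ 0 → p i % 8 = 1) (hn4 : n % 4 = 3)
    (hG : ∀ v, legendreMatrix p *ᵥ v = 0 → v = 0 ∨ v = fun _ => 1) :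
    Fintype.card {x : Fin (k + 1 + 1) → ZMod 2 // redeiMatrix (2 * n) (Fin.cons 2 p) *ᵥ x = 0} = 2 := by
  have h01 : ∀ c d : ZMod 2, c + d = 0 → c = d := by decide
  rw [Fintype.card_of_subtype ({0, fun _ => 1} : Finset (Fin (k + 1 + 1) → ZMod 2)) (fun x => ?_)]
  · exact Finset.card_pair fun h => zero_ne_one (congr_fun h 0)
  rw [Finset.mem_insert, Finset.mem_singleton]
  have hrow := redeiMatrix_two_mul_mulVec_caseThree p hp hinj h30 h1 hn4 x
  constructor
  · rintro (rfl | rfl)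
    · exact Matrix.mulVec_zero _
    · exact redeiMatrix_mulVec_one _ _
  · intro hx
    have h0 := congr_fun hx 0
    rw [hrow, Fin.cases_zero, Pi.zero_apply] at h0
    have hx0 : x 0 = x (Fin.succ 0) := h01 _ _ h0
    have hA : legendreMatrix p *ᵥ (x ∘ Fin.succ) = 0 := by
      funext a
      have := congr_fun hx a.succ
      have hz : (if a = 0 then x (Fin.succ 0) + x 0 else 0) = 0 := by
        split_ifs
        · rw [← hx0]; exact CharTwo.add_self_eq_zero _
        · rfl
      rw [hrow, Fin.cases_succ, Pi.zero_apply, hz, zero_add] at this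
      exact this
    rcases hG _ hA with hξ | hξ
    · left
      funext i
      refine Fin.cases ?_ (fun b => ?_) i
      · rw [hx0]; exact congr_fun hξ 0
      · exact congr_fun hξ b
    · right
      funext i
      refine Fin.cases ?_ (fun b => ?_) i
      · rw [hx0]; exact congr_fun hξ 0
      · exact congr_fun hξ b

end RedeiTwoNThree

/-- The tuple `(2; p₀, …, p_k)` on the class-`6` family: primes, injective, product `2n` — the side
conditions of the Rédei–Reichardt fact for `D = −8n` (`2n ≢ 1 (mod 4)`, so the prime tuple has product `2n`).
[cite: LiMa2008, Lemma 0.1 (p. 279: the primes of D)] -/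
theorem redei_side_conditions_cons_two_caseSix (hp : ∀ i, (p i).Prime) (hinj : Function.Injective p)
    (h3 : p 0 % 4 = 3) (h1 : ∀ i, i ≠ 0 → p i % 8 = 1) {n : ℕ} (hn : ∏ i, p i = n) :
    (∀ i, ((Fin.cons 2 p : Fin (k + 1 + 1) → ℕ) i).Prime) ∧
      Function.Injective (Fin.cons 2 p : Fin (k + 1 + 1) → ℕ) ∧
      (∏ i, (Fin.cons 2 p : Fin (k + 1 + 1) → ℕ) i) = 2 * n := by
  refine ⟨fun i => Fin.cases Nat.prime_two (fun a => by rw [Fin.cons_succ]; exact hp a) i, ?_, ?_⟩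
  · refine Fin.cons_injective_iff.mpr ⟨?_, hinj⟩
    rintro ⟨a, ha⟩
    exact ne_two_of_caseSix p h3 h1 a ha
  · rw [Fin.prod_univ_succ, Fin.cons_zero]
    simp only [Fin.cons_succ]
    rw [hn]

/-- **Tian 2014, Lemma 5.1 (direction ⇐), sub-case `p₀ ≡ 3 (mod 8)`, as a THEOREM modulo Rédei–Reichardt.**
For `n = p₀p₁⋯p_k` with `p₀ ≡ 3`, `pᵢ ≡ 1 (mod 8)` and `G(n)` odd (kernel form), every quadratic `K ∋ √−2n`
satisfies Tian's condition (1.1) in the case `n ≡ ±3 (mod 8)`: `dim_{𝔽₂} 𝒜[4]/𝒜[2] = 0`, i.e. `#(2𝒜 ∩ 𝒜[2]) = 1`.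
[cite: Tian2014, Lemma 5.1 (arXiv:1210.8231 p. 28, L2–L16) and Thm. 1.3 (1.1)] [cite: LiMa2008, Thm. 0.4 (p. 280)] -/
theorem condition11_caseThree (hR : redeiReichardt_fourTwoCard_classGroup) (hp : ∀ i, (p i).Prime)
    (hinj : Function.Injective p) (h30 : p 0 % 8 = 3) (h1 : ∀ i, i ≠ 0 → p i % 8 = 1)
    (hG : ∀ v, legendreMatrix p *ᵥ v = 0 → v = 0 ∨ v = fun _ => 1) {n : ℕ} (hn : ∏ i, p i = n)
    (K : Type) [Field K] [NumberField K] (hK : IsQuadraticFieldOfSqrt K (-(2 * n : ℤ))) :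
    Condition11 n K := by
  have hn8 : n % 8 = 3 := by rw [← hn, prod_mod_eight_caseSix p h1, h30]
  obtain ⟨hq, hqinj, hqprod⟩ := redei_side_conditions_cons_two_caseSix p hp hinj (by omega) h1 hn
  refine condition11_of_card_ker (p := Fin.cons 2 p) hR hq hqinj hqprod ?_ K hK
  rw [if_pos (Or.inl hn8)]
  exact card_ker_redeiMatrix_two_mul_caseThree p hp hinj h30 h1 (by omega) hG

/-- **Condition (1.1) on the whole class-`6` family** (`p₀ ≡ 3 (mod 4)`, `pᵢ ≡ 1 (mod 8)`, `G(n)` odd), modulo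
Rédei–Reichardt: (1.1) is a condition on `n` alone, so `p₀ ≡ 3 (mod 8)` is `condition11_caseThree` (dim `0`)
and `p₀ ≡ 7 (mod 8)` is the sibling's `condition11_caseSeven` (dim `1`).  This discharges the HYPOTHESIS (1.1)
of `thm13_rank_one_and_sha_odd` for `m = 2n` uniformly.
[cite: Tian2014, Lemma 5.1 (arXiv:1210.8231 p. 28, L2–L16) and Thm. 1.3 (1.1)] [cite: LiMa2008, Thm. 0.4 (p. 280)] -/
theorem condition11_caseSix (hR : redeiReichardt_fourTwoCard_classGroup) (hp : ∀ i, (p i).Prime)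
    (hinj : Function.Injective p) (h3 : p 0 % 4 = 3) (h1 : ∀ i, i ≠ 0 → p i % 8 = 1)
    (hG : ∀ v, legendreMatrix p *ᵥ v = 0 → v = 0 ∨ v = fun _ => 1) {n : ℕ} (hn : ∏ i, p i = n)
    (K : Type) [Field K] [NumberField K] (hK : IsQuadraticFieldOfSqrt K (-(2 * n : ℤ))) :
    Condition11 n K := by
  rcases mod_eight_zero_of_caseSix p h3 with h30 | h7
  · exact condition11_caseThree p hR hp hinj h30 h1 hG hn K hK
  · exact condition11_caseSeven p hR hp hinj h7 h1 hG hn K hK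

/-! ## §3 Tian 2014 Thm 1.3 for `m = 2n` on the family, condition (1.1) discharged (mod Thm 1.3, RR) -/

/-- **Tian 2014 Thm 1.3 ON THE CLASS-`6` GRAPH-FORM FAMILY, condition (1.1) discharged** (modulo the displayed
Thm 1.3 `h13` and Rédei–Reichardt `hR`): for `n = p₀p₁⋯p_k` (`p₀ ≡ 3 (mod 4)`, `pᵢ ≡ 1 (mod 8)`, distinct,
`G(n)` odd) and `m = 2n ≡ 6 (mod 8)`: `rank E_{2n}(ℚ) = 1 = ord_{s=1} L(E_{2n}, s)` and `Ш(E_{2n})` is finite of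
ODD order.  The quadratic field is instantiated as `GenusField (2n) = ℚ[X]/(X² + 2n) ∋ √−2n` and (1.1) is
`condition11_caseSix` (§2).
[cite: Tian2014, Thm. 1.3 with Lemma 5.1 and Thm. 5.2 (arXiv p. 2, L5–L15; p. 28, L2–L16, L40–L43)] [cite: LiMa2008, Thm. 0.4] -/
theorem thm13_two_mul_caseSix (h13 : thm13_rank_one_and_sha_odd) (hR : redeiReichardt_fourTwoCard_classGroup)
    (hp : ∀ i, (p i).Prime) (hinj : Function.Injective p) (h3 : p 0 % 4 = 3)
    (h1 : ∀ i, i ≠ 0 → p i % 8 = 1) (hG : ∀ v, legendreMatrix p *ᵥ v = 0 → v = 0 ∨ v = fun _ => 1)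
    {n : ℕ} (hn : ∏ i, p i = n) :
    (congruentNumberCurve (2 * n)).mordellWeilRank = 1 ∧ (congruentNumberCurve (2 * n)).analyticRank = 1 ∧
      Finite (congruentNumberCurve (2 * n)).sha ∧ Odd (Nat.card (congruentNumberCurve (2 * n)).sha) := by
  have hp2 : ∀ i, p i ≠ 2 := ne_two_of_caseSix p h3 h1
  have h6 : (2 * n) % 8 = 6 := hn ▸ two_mul_prod_mod_eight_caseSix p h3 h1
  have hn0 : 0 < n := hn ▸ Finset.prod_pos fun i _ => (hp i).pos
  have hK : IsQuadraticFieldOfSqrt (GenusField (2 * n)) (-(2 * n : ℤ)) := by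
    have h := isQuadraticFieldOfSqrt_genusField (d := 2 * n) (by omega)
    have hc : (-((2 * n : ℕ) : ℤ)) = -(2 * n : ℤ) := by push_cast; ring
    rwa [hc] at h
  exact h13 k p hp hp2 hinj h1 n hn.symm (GenusField (2 * n)) hK
    (condition11_caseSix p hR hp hinj h3 h1 hG hn _ hK) (2 * n) (Or.inr rfl) (Or.inr (Or.inl h6))

/-- From Tian's Thm 1.3 on the class-`6` graph-form family: `Ш(E_{2n})[2^∞] = 0` (`#Ш(E_{2n})(2) = 1`) — the
ALGEBRAIC `2`-part, modulo `h13` and `hR`. [cite: Tian2014, Thm. 1.3 and Rem. 1.4 (arXiv p. 2)] -/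
theorem card_primaryComponent_sha_two_two_mul_caseSix (h13 : thm13_rank_one_and_sha_odd)
    (hR : redeiReichardt_fourTwoCard_classGroup) (hp : ∀ i, (p i).Prime) (hinj : Function.Injective p)
    (h3 : p 0 % 4 = 3) (h1 : ∀ i, i ≠ 0 → p i % 8 = 1)
    (hG : ∀ v, legendreMatrix p *ᵥ v = 0 → v = 0 ∨ v = fun _ => 1) {n : ℕ} (hn : ∏ i, p i = n) :
    Nat.card (AddCommGroup.primaryComponent (congruentNumberCurve (2 * n)).sha 2) = 1 := by
  obtain ⟨-, -, hfin, hodd⟩ := thm13_two_mul_caseSix p h13 hR hp hinj h3 h1 hG hn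
  haveI := hfin
  haveI : Fact (2 : ℕ).Prime := ⟨Nat.prime_two⟩
  rw [card_addPrimaryComponent_eq_pow, Nat.factorization_eq_zero_of_not_dvd hodd.not_two_dvd_nat,
    pow_zero]

/-! ## §4 The PRINTED second genus sum `Σ₂′(2n)` of Tian–Yuan–Zhang Thm 1.2 is ODD on the family (mod RR) -/

/-- **`g(K)` odd ⟺ the Rédei kernel has `2` elements** (`r₄ = 0`), modulo Rédei–Reichardt, in the kernel-COUNT
currency of this file (`#ker RM(D) = 2^{t − rank}`). [cite: LiMa2008, Thm. 0.4 (p. 280)] [cite: TianYuanZhang2017, §1 (p0002 L85: "g(d) odd iff no class of exact order 4")] -/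
theorem odd_genusClassNumber_iff_card_ker_eq_two (hR : redeiReichardt_fourTwoCard_classGroup)
    {d t : ℕ} {q : Fin t → ℕ} (hq : ∀ i, (q i).Prime) (hinj : Function.Injective q)
    (hprod : ∏ i, q i = if d % 4 = 1 then 2 * d else d)
    (K : Type) [Field K] [NumberField K] (hK : IsQuadraticFieldOfSqrt K (-(d : ℤ))) :
    Odd (genusClassNumber K) ↔ Fintype.card {v : Fin t → ZMod 2 // redeiMatrix d q *ᵥ v = 0} = 2 := by
  rw [odd_genusClassNumber_iff_of_redeiReichardt hR hq hinj hprod K hK, card_ker_mulVec_eq]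
  have ht : 0 < t := pos_of_prod_eq hprod
  have hrk := rank_redeiMatrix_le d q ht
  constructor
  · intro h
    have h1 : t - (redeiMatrix d q).rank = 1 := by omega
    rw [h1, pow_one]
  · intro h
    have h1 : t - (redeiMatrix d q).rank = 1 :=
      Nat.pow_right_injective (le_refl 2) (h.trans (pow_one 2).symm)
    omega

/-- **`g(2) = #2Cl(ℚ(√−2))` is odd** (indeed `1`), modulo Rédei–Reichardt: one prime discriminant, `t = 1`,
`r₄ = t − 1 − rank = 0`. [cite: LiMa2008, Thm. 0.4 (p. 280)] [cite: TianYuanZhang2017, proof of Cor. 1.4 (chunk p0003 L36–L42)] -/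
theorem odd_genusClassNumber_two (hR : redeiReichardt_fourTwoCard_classGroup)
    (K : Type) [Field K] [NumberField K] (hK : IsQuadraticFieldOfSqrt K (-((2 : ℕ) : ℤ))) :
    Odd (genusClassNumber K) := by
  have hq : ∀ i, ((![2] : Fin 1 → ℕ) i).Prime := fun i => by fin_cases i; exact Nat.prime_two
  have hinj : Function.Injective (![2] : Fin 1 → ℕ) := fun i j _ => Subsingleton.elim i j
  have hprod : ∏ i, (![2] : Fin 1 → ℕ) i = if 2 % 4 = 1 then 2 * 2 else 2 := by decide
  rw [odd_genusClassNumber_iff_of_redeiReichardt hR hq hinj hprod K hK]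
  omega

/-- **`g(2s)` is EVEN for every divisor `s > 1` of `p₁⋯p_k`** (primes `≡ 1 (mod 8)`), modulo Rédei–Reichardt,
for every quadratic `K ∋ √−2s`: `2s ≡ 2 (mod 8)`, `disc K = −8s`, `D₂ = −8`, and in `RM(−8s)` the row AND the column
of the prime `2` vanish (`(p/2)`-bits vanish for `p ≡ 1 (mod 8)`; `(−8/p) = (−2/p) = +1` for `p ≡ 1 (mod 8)`), so
the kernel contains `0`, `e₂`, `(1,…,1)` — three elements, not two: `r₄ ≥ 1`.  Tian–Yuan–Zhang's second Rédei
bullet "`d = 2p₁⋯p_k`, `pᵢ ≡ ±1 (mod 8)`, `k > 0`" (here all `pᵢ ≡ 1`).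
[cite: TianYuanZhang2017, proof of Cor. 1.4 (chunk p0003 L36–L42)] [cite: LiMa2008, Thm. 0.4 with Lemma 0.1 (D = −8s, D₂ = −8)] -/
theorem even_genusClassNumber_two_mul_of_dvd (hR : redeiReichardt_fourTwoCard_classGroup)
    (hp : ∀ i, (p i).Prime) (hinj : Function.Injective p)
    (h1 : ∀ i, i ≠ 0 → p i % 8 = 1) {s : ℕ} (hs : s ∣ ∏ i, p i) (h0 : ¬ p 0 ∣ s) (hs1 : 1 < s)
    (K : Type) [Field K] [NumberField K] (hK : IsQuadraticFieldOfSqrt K (-((2 * s : ℕ) : ℤ))) :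
    Even (genusClassNumber K) := by
  -- the index type of the odd primes of `s` and the tuple `(2; pᵢ ∣ s)`
  set S := {i : Fin (k + 1) // p i ∣ s} with hS
  have hi0 : ∀ a : S, a.1 ≠ 0 := fun a h => h0 (h ▸ a.2)
  have h8S : ∀ a : S, p a.1 % 8 = 1 := fun a => h1 _ (hi0 a)
  have hsprod : ∏ a : S, p a.1 = s := prod_subtype_dvd_eq p hp hinj hs
  have hs8 : s % 8 = 1 := by
    rw [← hsprod, Finset.prod_nat_mod]
    simp only [h8S, Finset.prod_const_one, Nat.one_mod]
  have hd4 : ¬ (2 * s) % 4 = 1 := by omega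
  have hne : Nonempty S := by
    by_contra h
    rw [not_nonempty_iff] at h
    rw [Fintype.prod_empty] at hsprod
    omega
  obtain ⟨a₀⟩ := hne
  set q : Option S → ℕ := fun o => o.elim 2 fun a => p a.1 with hq
  have hqp : ∀ o, (q o).Prime := by
    rintro (_ | a)
    · exact Nat.prime_two
    · exact hp a.1
  have hqinj : Function.Injective q := by
    rintro (_ | a) (_ | b) h
    · rfl
    · exfalso
      have h2 : p b.1 = 2 := by simpa [hq] using h.symm
      have := h8S b; omega
    · exfalso
      have h2 : p a.1 = 2 := by simpa [hq] using h
      have := h8S a; omega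
    · simp only [hq, Option.elim_some] at h
      exact congrArg some (Subtype.ext (hinj h))
  have hqprod : ∏ o, q o = if (2 * s) % 4 = 1 then 2 * (2 * s) else 2 * s := by
    rw [if_neg hd4, Fintype.prod_option]
    simp only [hq, Option.elim_none, Option.elim_some]
    rw [hsprod]
  -- the Rédei matrix on `Option S` and three of its null vectors
  set M : Matrix (Option S) (Option S) (ZMod 2) := Matrix.of fun a b : Option S =>
    if a = b then ∑ c ∈ univ.erase a, kroneckerBit (primeDisc (2 * s) (q c)) (q a)
    else kroneckerBit (primeDisc (2 * s) (q b)) (q a) with hM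
  have hdiag : ∀ a, M a a = ∑ c ∈ univ.erase a, M a c := by
    intro a
    simp only [hM, Matrix.of_apply]
    exact Finset.sum_congr rfl fun c hc => by rw [if_neg (Finset.ne_of_mem_erase hc).symm]
  have hrow2 : ∀ a : S, M none (some a) = 0 := by
    intro a
    have h2 : p a.1 ≠ 2 := by have := h8S a; omega
    simp only [hM, Matrix.of_apply, reduceCtorEq, if_false, hq, Option.elim_none, Option.elim_some]
    rw [primeDisc_of_ne_two _ h2, if_pos (by have := h8S a; omega)]
    exact kroneckerBit_two_of_mod_eight_one (h8S a)
  have hcol2 : ∀ a : S, M (some a) none = 0 := by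
    intro a
    simp only [hM, Matrix.of_apply, reduceCtorEq, if_false, hq, Option.elim_none, Option.elim_some]
    have : primeDisc (2 * s) 2 = -8 := by
      unfold primeDisc; rw [if_pos rfl, if_neg hd4, if_neg (by omega)]
    rw [this, kroneckerBit_neg_eight_eq_ite (hp a.1) (by have := h8S a; omega),
      if_neg (by have := h8S a; omega)]
  set e₂ : Option S → ZMod 2 := fun o => o.elim 1 fun _ => 0 with he₂
  have hMe : M *ᵥ e₂ = 0 := by
    funext o
    rw [mulVec_apply_eq_sum_of_diag M hdiag, Pi.zero_apply, Fintype.sum_option]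
    rcases o with _ | a
    · simp only [he₂, Option.elim_none, Option.elim_some, CharTwo.add_self_eq_zero, mul_zero, zero_add,
        add_zero, mul_one]
      exact Finset.sum_eq_zero fun a _ => hrow2 a
    · simp only [he₂, Option.elim_none, Option.elim_some, zero_add, mul_one, add_zero, mul_zero,
        Finset.sum_const_zero, hcol2 a]
  have hM1 : M *ᵥ (fun _ => (1 : ZMod 2)) = 0 := by
    funext o
    rw [mulVec_apply_eq_sum_of_diag M hdiag, Pi.zero_apply]
    simp only [CharTwo.add_self_eq_zero, mul_zero, Finset.sum_const_zero]
  have hM0 : M *ᵥ (0 : Option S → ZMod 2) = 0 := Matrix.mulVec_zero _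
  have h3 : ({⟨0, hM0⟩, ⟨e₂, hMe⟩, ⟨fun _ => 1, hM1⟩} :
      Finset {v : Option S → ZMod 2 // M *ᵥ v = 0}).card = 3 := by
    rw [Finset.card_insert_of_notMem, Finset.card_pair]
    · intro h
      have := congr_fun (congrArg Subtype.val h) (some a₀)
      simp [he₂] at this
    · simp only [Finset.mem_insert, Finset.mem_singleton, not_or]
      refine ⟨fun h => ?_, fun h => ?_⟩
      · have := congr_fun (congrArg Subtype.val h) none
        simp [he₂] at this
      · have := congr_fun (congrArg Subtype.val h) none
        simp at this
  have hle := Finset.card_le_univ ({⟨0, hM0⟩, ⟨e₂, hMe⟩, ⟨fun _ => 1, hM1⟩} :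
      Finset {v : Option S → ZMod 2 // M *ᵥ v = 0})
  rw [h3] at hle
  have key := odd_genusClassNumber_iff_card_ker_of_redeiReichardt hR q hqp hqinj hqprod K hK
  rw [← Nat.not_odd_iff_even]
  intro hodd
  have h2 := key.mp hodd
  change Fintype.card {v : Option S → ZMod 2 // M *ᵥ v = 0} = 2 at h2
  omega

/-- **`g(2n)` is ODD on the sub-family `p₀ ≡ 3 (mod 8)`** (`K ∋ √−2n`), modulo Rédei–Reichardt: `RM(−8n)` has a
`2`-element kernel (§2) — (1.1) with dim `0`. [cite: Tian2014, Lemma 5.1 (arXiv p. 28 L2–L16)] [cite: LiMa2008, Thm. 0.4 (p. 280)] -/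
theorem odd_genusClassNumber_two_mul_caseThree (hR : redeiReichardt_fourTwoCard_classGroup)
    (hp : ∀ i, (p i).Prime) (hinj : Function.Injective p) (h30 : p 0 % 8 = 3)
    (h1 : ∀ i, i ≠ 0 → p i % 8 = 1) (hG : ∀ v, legendreMatrix p *ᵥ v = 0 → v = 0 ∨ v = fun _ => 1)
    {n : ℕ} (hn : ∏ i, p i = n) (K : Type) [Field K] [NumberField K]
    (hK : IsQuadraticFieldOfSqrt K (-((2 * n : ℕ) : ℤ))) : Odd (genusClassNumber K) := by
  have hn4 : n % 4 = 3 := by have := hn ▸ prod_mod_eight_caseSix p h1; omega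
  obtain ⟨hq, hqinj, hqprod⟩ := redei_side_conditions_cons_two_caseSix p hp hinj (by omega) h1 hn
  have hqprod' : ∏ i, (Fin.cons 2 p : Fin (k + 1 + 1) → ℕ) i =
      if (2 * n) % 4 = 1 then 2 * (2 * n) else 2 * n := by rw [if_neg (by omega), hqprod]
  rw [odd_genusClassNumber_iff_card_ker_eq_two hR hq hqinj hqprod' K hK]
  exact card_ker_redeiMatrix_two_mul_caseThree p hp hinj h30 h1 hn4 hG

/-- **`g(2n)` is EVEN on the sub-family `p₀ ≡ 7 (mod 8)`** (`K ∋ √−2n`), modulo Rédei–Reichardt: `RM(−8n)` has a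
`4`-element kernel (sibling file, §3) — (1.1) with dim `1`. [cite: Tian2014, Lemma 5.1 (arXiv p. 28 L2–L16)] [cite: LiMa2008, Thm. 0.4 (p. 280)] -/
theorem even_genusClassNumber_two_mul_caseSeven (hR : redeiReichardt_fourTwoCard_classGroup)
    (hp : ∀ i, (p i).Prime) (hinj : Function.Injective p) (h7 : p 0 % 8 = 7)
    (h1 : ∀ i, i ≠ 0 → p i % 8 = 1) (hG : ∀ v, legendreMatrix p *ᵥ v = 0 → v = 0 ∨ v = fun _ => 1)
    {n : ℕ} (hn : ∏ i, p i = n) (K : Type) [Field K] [NumberField K]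
    (hK : IsQuadraticFieldOfSqrt K (-((2 * n : ℕ) : ℤ))) : Even (genusClassNumber K) := by
  have hn8 : n % 8 = 7 := by rw [← hn, prod_mod_eight_caseSix p h1, h7]
  obtain ⟨hq, hqinj, hqprod⟩ := redei_side_conditions_cons_two_caseSix p hp hinj (by omega) h1 hn
  have hqprod' : ∏ i, (Fin.cons 2 p : Fin (k + 1 + 1) → ℕ) i =
      if (2 * n) % 4 = 1 then 2 * (2 * n) else 2 * n := by rw [if_neg (by omega), hqprod]
  rw [← Nat.not_odd_iff_even, odd_genusClassNumber_iff_card_ker_eq_two hR hq hqinj hqprod' K hK,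
    card_ker_redeiMatrix_two_mul_caseSeven p hp hinj h7 h1 hG hn8]
  omega

/-- **Decompositions of `2n` on the family: `{2n}`, `{2, n}`, or a block `d ≠ 2` prime to `p₀`.**  If every
block `≠ 2` of a decomposition `2n = d₀⋯d_ℓ` (pairwise coprime blocks `> 1`) were divisible by `p₀`, there would
be at most one such block, so the decomposition is `{2n}` or `{2, n}`.
[cite: TianYuanZhang2017, Thm. 1.2 ("all decompositions n = d₀⋯d_ℓ are non-ordered with all dᵢ > 1")] -/
theorem decompositions_two_mul_cases (hp : ∀ i, (p i).Prime) {n : ℕ} (hn : ∏ i, p i = n)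
    {D : Finset ℕ} (hD : D ∈ decompositions (2 * n)) :
    D = {2 * n} ∨ D = {2, n} ∨ ∃ d ∈ D, d ≠ 2 ∧ ¬ p 0 ∣ d := by
  by_cases hN : D = {2 * n}
  · exact Or.inl hN
  by_cases h2n : D = {2, n}
  · exact Or.inr (Or.inl h2n)
  refine Or.inr (Or.inr ?_)
  by_contra hall
  push Not at hall
  have hn1 : 1 < n := hn ▸ one_lt_prod_caseSix p hp
  have hp0n : p 0 ∣ 2 * n := hn ▸ (Finset.dvd_prod_of_mem p (Finset.mem_univ 0)).mul_left 2
  obtain ⟨d, hdD, hd0⟩ := exists_mem_not_dvd_of_mem_decompositions (hp 0) hp0n hD hN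
  have hd2 : d = 2 := by
    by_contra h
    exact hd0 (hall d hdD h)
  subst hd2
  have hD' := hD
  simp only [decompositions, Finset.mem_filter, Finset.mem_powerset] at hD'
  obtain ⟨-, hgt, hcop, hprod⟩ := hD'
  -- the other blocks are all divisible by `p₀`, hence there is at most one of them
  have hcard : (D.erase 2).card ≤ 1 := by
    refine Finset.card_le_one.mpr fun a ha b hb => ?_
    by_contra hab
    have ha' := Finset.mem_erase.mp ha
    have hb' := Finset.mem_erase.mp hb
    have hc : Nat.Coprime a b := hcop ha'.2 hb'.2 hab
    have : p 0 ∣ Nat.gcd a b := Nat.dvd_gcd (hall a ha'.2 ha'.1) (hall b hb'.2 hb'.1)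
    rw [hc] at this
    exact (hp 0).one_lt.ne' (Nat.dvd_one.mp this)
  have hprod' : 2 * ∏ e ∈ D.erase 2, e = 2 * n := by
    rw [Finset.mul_prod_erase D (fun e => e) hdD, hprod]
  have hprod'' : ∏ e ∈ D.erase 2, e = n := Nat.eq_of_mul_eq_mul_left two_pos hprod'
  rcases (D.erase 2).eq_empty_or_nonempty with he | ⟨a, ha⟩
  · rw [he, Finset.prod_empty] at hprod''
    omega
  · have hDa : D.erase 2 = {a} := Finset.eq_singleton_iff_unique_mem.mpr
      ⟨ha, fun b hb => Finset.card_le_one.mp hcard b hb a ha⟩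
    rw [hDa, Finset.prod_singleton] at hprod''
    apply h2n
    rw [← Finset.insert_erase hdD, hDa, hprod'']

/-- **The even factor.**  On the family, a block `d ≠ 2` prime to `p₀` of a decomposition of `2n` has `g(d)` even
(`K_d = GenusField d`): `d` odd gives `1 < d ∣ p₁⋯p_k` (`even_genusClassNumber_of_dvd_caseSeven`), `d = 2s` gives
`1 < s ∣ p₁⋯p_k` (`even_genusClassNumber_two_mul_of_dvd`). [cite: TianYuanZhang2017, proof of Cor. 1.4 (chunk p0003 L36–L42: the Rédei bullets)] -/
theorem even_genusClassNumber_of_mem_decompositions_two_mul (hR : redeiReichardt_fourTwoCard_classGroup)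
    (hp : ∀ i, (p i).Prime) (hinj : Function.Injective p)
    (h1 : ∀ i, i ≠ 0 → p i % 8 = 1) {n : ℕ} (hn : ∏ i, p i = n) {D : Finset ℕ}
    (hD : D ∈ decompositions (2 * n)) {d : ℕ} (hdD : d ∈ D) (hd2 : d ≠ 2) (hd0 : ¬ p 0 ∣ d) :
    Even (genusClassNumber (GenusField d)) := by
  simp only [decompositions, Finset.mem_filter, Finset.mem_powerset] at hD
  obtain ⟨hsub, hgt, -, -⟩ := hD
  have hdN : d ∣ 2 * n := Nat.dvd_of_mem_divisors (hsub hdD)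
  have hd1 : 1 < d := hgt d hdD
  by_cases h2d : 2 ∣ d
  · obtain ⟨s, rfl⟩ := h2d
    have hsn : s ∣ n := Nat.dvd_of_mul_dvd_mul_left two_pos hdN
    have hs0 : ¬ p 0 ∣ s := fun h => hd0 (h.mul_left 2)
    have hs1 : 1 < s := by
      rcases Nat.lt_or_ge 1 s with h | h
      · exact h
      · interval_cases s <;> omega
    exact even_genusClassNumber_two_mul_of_dvd p hR hp hinj h1 (hn ▸ hsn) hs0 hs1 (GenusField (2 * s))
      (isQuadraticFieldOfSqrt_genusField (d := 2 * s) (by omega))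
  · have hc : Nat.Coprime d 2 := ((Nat.Prime.coprime_iff_not_dvd Nat.prime_two).mpr h2d).symm
    have hdn : d ∣ n := hc.dvd_of_dvd_mul_left hdN
    exact even_genusClassNumber_of_dvd_caseSeven p hR hp hinj h1 (hn ▸ hdn) hd0 hd1 (GenusField d)
      (isQuadraticFieldOfSqrt_genusField hd1.le)

/-- `{2, n}` is a decomposition of `2n` for odd `n > 1`. [cite: TianYuanZhang2017, Thm. 1.2 (decompositions: pairwise coprime factors > 1 with product n)] -/
theorem pair_mem_decompositions_two_mul {n : ℕ} (hn1 : 1 < n) (hodd : Odd n) :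
    ({2, n} : Finset ℕ) ∈ decompositions (2 * n) := by
  have h2n : (2 : ℕ) ≠ n := fun h => by
    rw [← h] at hodd; exact (Nat.not_odd_iff_even.mpr even_two) hodd
  have hcop : Nat.Coprime 2 n := (Nat.Prime.coprime_iff_not_dvd Nat.prime_two).mpr hodd.not_two_dvd_nat
  simp only [decompositions, Finset.mem_filter, Finset.mem_powerset]
  refine ⟨?_, ?_, ?_, ?_⟩
  · intro d hd
    rw [Finset.mem_insert, Finset.mem_singleton] at hd
    rw [Nat.mem_divisors]
    rcases hd with rfl | rfl
    · exact ⟨dvd_mul_right 2 n, by omega⟩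
    · exact ⟨dvd_mul_left _ _, by omega⟩
  · intro d hd
    rw [Finset.mem_insert, Finset.mem_singleton] at hd
    rcases hd with rfl | rfl <;> omega
  · rw [Finset.coe_pair, Set.pairwise_pair]
    exact fun _ => ⟨hcop, hcop.symm⟩
  · exact Finset.prod_pair h2n

/-- **The PRINTED second genus sum `Σ₂′(2n)` is ODD on Tian's class-`6` family** (modulo Rédei–Reichardt): for
`n = p₀p₁⋯p_k` (`p₀ ≡ 3 (mod 4)`, `pᵢ ≡ 1 (mod 8)`, `G(n)` odd),
`Σ₂′(2n) = Σ_{2n = d₀d₁⋯d_ℓ, d₀ ≡ 5,6,7, d₁ ≡ 1,2,3, dᵢ ≡ 1 (mod 8)} ∏ g(dᵢ)` (ALL terms, incl. `ℓ = 0`; `genusSum₂'`) over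
the fields `K_d = GenusField d` is odd.  Indeed every decomposition other than `{2n}`, `{2, n}` carries a block with
even `g` (`even_genusClassNumber_of_mem_decompositions_two_mul`); `{2, n}` is counted iff `n ≡ 7 (mod 8)`; and
`g(2n) + [n ≡ 7]·g(2)g(n)` is odd in both sub-cases (`p₀ ≡ 3`: `g(2n)` odd; `p₀ ≡ 7`: `g(2n)` even, `g(2)`, `g(n)`
odd).  This is the hypothesis "`Σ₂′ ≢ 0 (mod 2)`" of the class-`6` clause of TYZ Thm 1.2, uniformly in `k`.
[cite: TianYuanZhang2017, Thm. 1.2 (chunk p0002 L121–L129) and proof of Cor. 1.4 (p0003 L35–L50)] [cite: LiMa2008, Thm. 0.4] -/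
theorem odd_genusSum₂'_two_mul_caseSix (hR : redeiReichardt_fourTwoCard_classGroup) (hp : ∀ i, (p i).Prime)
    (hinj : Function.Injective p) (h3 : p 0 % 4 = 3) (h1 : ∀ i, i ≠ 0 → p i % 8 = 1)
    (hG : ∀ v, legendreMatrix p *ᵥ v = 0 → v = 0 ∨ v = fun _ => 1) {n : ℕ} (hn : ∏ i, p i = n) :
    Odd (genusSum₂' (2 * n) fun d => genusClassNumber (GenusField d)) := by
  have hn1 : 1 < n := hn ▸ one_lt_prod_caseSix p hp
  have hn8 : n % 8 = p 0 % 8 := hn ▸ prod_mod_eight_caseSix p h1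
  have hnodd : Odd n := Nat.odd_iff.mpr (by omega)
  have hN8 : (2 * n) % 8 = 6 := by omega
  have hN1 : 1 < 2 * n := by omega
  have h2n : (2 : ℕ) ≠ n := by omega
  unfold genusSum₂'
  set g : ℕ → ℕ := fun d => genusClassNumber (GenusField d) with hg
  set P : Finset ℕ → Prop := fun D => ∃ d₀ ∈ D, (d₀ % 8 = 5 ∨ d₀ % 8 = 6 ∨ d₀ % 8 = 7) ∧
      (∀ d ∈ D, d ≠ d₀ → (d % 8 = 1 ∨ d % 8 = 2 ∨ d % 8 = 3)) ∧
      ((D.erase d₀).filter fun d => d % 8 ≠ 1).card ≤ 1 with hP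
  set F := (decompositions (2 * n)).filter P with hF
  -- `{2n}` is counted
  have hNmem : ({2 * n} : Finset ℕ) ∈ F := by
    rw [hF, Finset.mem_filter]
    refine ⟨singleton_mem_decompositions hN1, 2 * n, Finset.mem_singleton_self _, Or.inr (Or.inl hN8),
      fun d hd hne => absurd (Finset.mem_singleton.mp hd) hne, ?_⟩
    rw [Finset.erase_singleton, Finset.filter_empty, Finset.card_empty]
    exact zero_le_one
  -- the parity of every other term
  have hrest : ∀ D ∈ F, D ≠ {2 * n} → D ≠ {2, n} → 2 ∣ ∏ d ∈ D, g d := by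
    intro D hDF hDN hD2
    rw [hF, Finset.mem_filter] at hDF
    rcases decompositions_two_mul_cases p hp hn hDF.1 with h | h | ⟨d, hdD, hd2, hd0⟩
    · exact absurd h hDN
    · exact absurd h hD2
    · exact dvd_trans (even_iff_two_dvd.mp
        (even_genusClassNumber_of_mem_decompositions_two_mul p hR hp hinj h1 hn hDF.1 hdD hd2 hd0))
        (Finset.dvd_prod_of_mem _ hdD)
  rw [← Finset.add_sum_erase F _ hNmem, Finset.prod_singleton]
  rcases mod_eight_zero_of_caseSix p h3 with h30 | h7
  · -- `p₀ ≡ 3 (mod 8)`: `Σ₂′(2n) ≡ g(2n)`, odd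
    refine Odd.add_even ?_ ?_
    · exact odd_genusClassNumber_two_mul_caseThree p hR hp hinj h30 h1 hG hn (GenusField (2 * n))
        (isQuadraticFieldOfSqrt_genusField (d := 2 * n) (by omega))
    · rw [even_iff_two_dvd]
      refine Finset.dvd_sum fun D hD => ?_
      have hDN := Finset.ne_of_mem_erase hD
      have hDF := Finset.mem_of_mem_erase hD
      refine hrest D hDF hDN fun hD2 => ?_
      -- `{2, n}` is not counted for `n ≡ 3 (mod 8)`
      rw [hF, Finset.mem_filter, hD2] at hDF
      obtain ⟨d₀, hd₀, h567, -, -⟩ := hDF.2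
      rw [Finset.mem_insert, Finset.mem_singleton] at hd₀
      rcases hd₀ with rfl | rfl <;> omega
  · -- `p₀ ≡ 7 (mod 8)`: `Σ₂′(2n) ≡ g(2n) + g(2)g(n)`, `g(2n)` even, `g(2)`, `g(n)` odd
    have h2nmem : ({2, n} : Finset ℕ) ∈ F.erase {2 * n} := by
      refine Finset.mem_erase.mpr ⟨fun h => ?_, ?_⟩
      · have : (2 : ℕ) ∈ ({2 * n} : Finset ℕ) := h ▸ Finset.mem_insert_self 2 {n}
        rw [Finset.mem_singleton] at this
        omega
      · rw [hF, Finset.mem_filter]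
        refine ⟨pair_mem_decompositions_two_mul hn1 hnodd, n, by simp, Or.inr (Or.inr (by omega)),
          fun d hd hne => ?_, ?_⟩
        · rw [Finset.mem_insert, Finset.mem_singleton] at hd
          rcases hd with rfl | rfl
          · exact Or.inr (Or.inl rfl)
          · exact absurd rfl hne
        · refine (Finset.card_filter_le _ _).trans ?_
          rw [Finset.card_erase_of_mem (by simp), Finset.card_pair h2n]
    rw [← Finset.add_sum_erase _ _ h2nmem, Finset.prod_pair h2n]
    refine Even.add_odd ?_ (Odd.add_even ?_ ?_)
    · exact even_genusClassNumber_two_mul_caseSeven p hR hp hinj h7 h1 hG hn (GenusField (2 * n))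
        (isQuadraticFieldOfSqrt_genusField (d := 2 * n) (by omega))
    · exact (odd_genusClassNumber_two hR (GenusField 2) (isQuadraticFieldOfSqrt_genusField one_le_two)).mul
        (odd_genusClassNumber_caseSeven p hR hp hinj h7 h1 hG hn (GenusField n)
          (isQuadraticFieldOfSqrt_genusField hn1.le))
    · rw [even_iff_two_dvd]
      refine Finset.dvd_sum fun D hD => ?_
      have hD2 := Finset.ne_of_mem_erase hD
      have hD' := Finset.mem_of_mem_erase hD
      exact hrest D (Finset.mem_of_mem_erase hD') (Finset.ne_of_mem_erase hD') hD2

/-! ## §5 The rank-one datum of TYZ Thm 1.2 AS PRINTED on the family, at the printed generality `2^ρ = [E_{2n}(ℚ) : φ(A(ℚ)) + E_{2n}[2]]` -/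

/-- `2k(2n) − 2 − a(2n) = 2k` for `n = p₀p₁⋯p_k` with distinct odd primes (`k(2n) = k + 1`, `a(2n) = 0`).
[cite: TianYuanZhang2017, §1 (chunk p0002 L63–L65: k(n), a(n))] -/
theorem twoExponent_two_mul_caseSix (hp : ∀ i, (p i).Prime) (hinj : Function.Injective p) (h3 : p 0 % 4 = 3)
    (h1 : ∀ i, i ≠ 0 → p i % 8 = 1) : twoExponent (2 * ∏ i, p i) = 2 * (k : ℤ) := by
  have hodd := odd_of_caseSix p h3 h1
  have hprod : ∏ i, p i = ∏ q ∈ univ.image p, q := by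
    rw [Finset.prod_image fun i _ j _ h => hinj h]
  have hpf : (∏ i, p i).primeFactors = univ.image p := by
    rw [hprod, Nat.primeFactors_prod]
    simpa using fun i => hp i
  have hn0 : (∏ i, p i) ≠ 0 := Finset.prod_ne_zero_iff.mpr fun i _ => (hp i).ne_zero
  have h2 : (2 : ℕ) ∉ univ.image p := by
    intro h
    obtain ⟨i, -, hi⟩ := Finset.mem_image.mp h
    exact ne_two_of_caseSix p h3 h1 i hi
  have hpf2 : (2 * ∏ i, p i).primeFactors = insert 2 (univ.image p) := by
    rw [Nat.primeFactors_mul two_ne_zero hn0, Nat.Prime.primeFactors Nat.prime_two, hpf, Finset.insert_eq]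
  have hk : oddPrimeFactorCount (2 * ∏ i, p i) = k + 1 := by
    rw [oddPrimeFactorCount, hpf2, Finset.filter_insert, if_neg (Nat.not_odd_iff_even.mpr even_two),
      Finset.filter_true_of_mem (by simpa using fun i => hodd i),
      Finset.card_image_of_injective _ hinj, Finset.card_univ, Fintype.card_fin]
  have ha : oddIndicator (2 * ∏ i, p i) = 0 := by
    rw [oddIndicator, if_pos (even_two_mul _)]
  rw [twoExponent, hk, ha]
  push_cast
  ring

/-- **The rank-one datum on Tian's class-`6` family at the index `2^ρ`, modulo TYZ Thm 1.2 AS PRINTED (`h12`) and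
Rédei–Reichardt (`hR`).**  For `n = p₀p₁⋯p_k` (`p₀ ≡ 3 (mod 4)`, `pᵢ ≡ 1 (mod 8)`, distinct, `G(n)` odd) and any `ρ`
with `[E_{2n}(ℚ) : φ(A(ℚ)) + E_{2n}[2]] = 2^ρ`: `ord_{s=1} L(E_{2n}, s) = 1` and
`L′(E_{2n}, 1) = 2^{2k} · L² · Ω(E_{2n}) · Reg(E_{2n})` with `L ∈ ℤ`, `L ≠ 0`, `ord₂ L ≤ ρ` — the class-`6` clause of
Thm 1.2 (`Σ₂′(2n)` odd, §4) through `rankOneDatum_of_index_eq_two_pow_six'`.  No L-value is computed.  At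
`ρ ≥ 1` the PARITY of `L` — i.e. the `2`-part of BSD for `E_{2n}`, given §3 — is NOT decided by the printed
theorem (module docstring, "What is NOT proved").
[cite: TianYuanZhang2017, Thm. 1.2 (chunk p0002 L121–L129), Thm. 3.5 (p0011 L94–L112) and §1 (1.1)] [cite: LiMa2008, Thm. 0.4] -/
theorem rankOneDatum_two_mul_caseSix' (h12 : thm12_parity_of_scriptL')
    (hR : redeiReichardt_fourTwoCard_classGroup) (hp : ∀ i, (p i).Prime) (hinj : Function.Injective p)
    (h3 : p 0 % 4 = 3) (h1 : ∀ i, i ≠ 0 → p i % 8 = 1)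
    (hG : ∀ v, legendreMatrix p *ᵥ v = 0 → v = 0 ∨ v = fun _ => 1) {n : ℕ} (hn : ∏ i, p i = n)
    {ρ : ℕ} (hρ : (rhoSubgroup (2 * n)).index = 2 ^ ρ) :
    ∃ L : ℤ, L ≠ 0 ∧ padicValInt 2 L ≤ ρ ∧ (congruentNumberCurve (2 * n)).analyticRank = 1 ∧
      deriv (congruentNumberCurve (2 * n)).entireLFunction 1 =
        (2 : ℂ) ^ (2 * (k : ℤ)) * (L : ℂ) ^ 2 *
          ((congruentNumberCurve (2 * n)).realPeriodRat : ℂ) * ((congruentNumberCurve (2 * n)).regulator : ℂ) := by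
  have hsq : Squarefree (2 * n) :=
    hn ▸ squarefree_two_mul_prod_of_injective p hp (odd_of_caseSix p h3 h1) hinj
  have h8 : (2 * n) % 8 = 6 := hn ▸ two_mul_prod_mod_eight_caseSix p h3 h1
  have hexp : twoExponent (2 * n) = 2 * (k : ℤ) := hn ▸ twoExponent_two_mul_caseSix p hp hinj h3 h1
  obtain ⟨L, hL0, hval, hr, hd⟩ := rankOneDatum_of_index_eq_two_pow_six' h12 hsq h8 hρ GenusField
    (isGenusFieldFamily_genusField (2 * n)) (odd_genusSum₂'_two_mul_caseSix p hR hp hinj h3 h1 hG hn)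
  exact ⟨L, hL0, hval, hr, hexp ▸ hd⟩

/-- **`ord_{s=1} L(E_{2n}, s) = 1` on Tian's class-`6` family from TYZ Thm 1.2 AS PRINTED** (any index `2^ρ`),
modulo `h12` and `hR` — Tian's Thm 1.3 prints the same conclusion on this family (§3, modulo `h13`); here it is
the genus-period parity route. [cite: TianYuanZhang2017, Thm. 1.2 and §1 (definition of 𝓛(n))] [cite: Tian2014, Thm. 1.3 (arXiv p. 2, L5–L15)] -/
theorem analyticRank_two_mul_caseSix' (h12 : thm12_parity_of_scriptL')
    (hR : redeiReichardt_fourTwoCard_classGroup) (hp : ∀ i, (p i).Prime) (hinj : Function.Injective p)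
    (h3 : p 0 % 4 = 3) (h1 : ∀ i, i ≠ 0 → p i % 8 = 1)
    (hG : ∀ v, legendreMatrix p *ᵥ v = 0 → v = 0 ∨ v = fun _ => 1) {n : ℕ} (hn : ∏ i, p i = n)
    {ρ : ℕ} (hρ : (rhoSubgroup (2 * n)).index = 2 ^ ρ) :
    (congruentNumberCurve (2 * n)).analyticRank = 1 := by
  obtain ⟨-, -, -, hr, -⟩ := rankOneDatum_two_mul_caseSix' p h12 hR hp hinj h3 h1 hG hn hρ
  exact hr

/-- **The rank-one datum at `ρ(2n) = 0`** (`[E_{2n}(ℚ) : φ(A(ℚ)) + E_{2n}[2]] = 1`), modulo `h12`, `hR`: then `L` is ODD,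
so that — with §3 (`#Ш(E_{2n})` odd), `#E_{2n}(ℚ)_tor = 4` and `∏ c_ℓ(E_{2n}) = 2^{2k+4}` — the `2`-adic valuations
on both sides of the BSD formula agree (assembled by the sub-lane's `P2/` door, not here).  On Tian's class-`6`
family the index is `2` in every computed case (sub-lane census, EVIDENCE), so this door is recorded for
completeness only. [cite: TianYuanZhang2017, Thm. 1.2 and §1 (1.1)] [cite: LiMa2008, Thm. 0.4] -/
theorem rankOneDatum_two_mul_caseSix_of_index_eq_one' (h12 : thm12_parity_of_scriptL')
    (hR : redeiReichardt_fourTwoCard_classGroup) (hp : ∀ i, (p i).Prime) (hinj : Function.Injective p)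
    (h3 : p 0 % 4 = 3) (h1 : ∀ i, i ≠ 0 → p i % 8 = 1)
    (hG : ∀ v, legendreMatrix p *ᵥ v = 0 → v = 0 ∨ v = fun _ => 1) {n : ℕ} (hn : ∏ i, p i = n)
    (hρ : (rhoSubgroup (2 * n)).index = 1) :
    ∃ L : ℤ, Odd L ∧ (congruentNumberCurve (2 * n)).analyticRank = 1 ∧
      deriv (congruentNumberCurve (2 * n)).entireLFunction 1 =
        (2 : ℂ) ^ (2 * (k : ℤ)) * (L : ℂ) ^ 2 *
          ((congruentNumberCurve (2 * n)).realPeriodRat : ℂ) * ((congruentNumberCurve (2 * n)).regulator : ℂ) := by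
  have hsq : Squarefree (2 * n) :=
    hn ▸ squarefree_two_mul_prod_of_injective p hp (odd_of_caseSix p h3 h1) hinj
  have h8 : (2 * n) % 8 = 6 := hn ▸ two_mul_prod_mod_eight_caseSix p h3 h1
  have hexp : twoExponent (2 * n) = 2 * (k : ℤ) := hn ▸ twoExponent_two_mul_caseSix p hp hinj h3 h1
  obtain ⟨L, hL, hr, hd⟩ := rankOneDatum_of_index_eq_one_six' h12 hsq h8 hρ GenusField
    (isGenusFieldFamily_genusField (2 * n)) (odd_genusSum₂'_two_mul_caseSix p hR hp hinj h3 h1 hG hn)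
  exact ⟨L, hL, hr, hexp ▸ hd⟩

end Literature.NumberTheory.EllipticCurves.Tian2014

end
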